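import Summits.QuantumFields.YangMills.Theorems.LuscherReductionTwistedTraceScalingBODefectCoreData
import Summits.QuantumFields.YangMills.Theorems.LuscherReductionTwistedTraceScalingBOCoreDefectPointwise
import Summits.QuantumFields.YangMills.Theorems.LuscherReductionTwistedTraceScalingBTFixedBeta
import HarnessLib

/-!
# (C4)/(C5): the transfer of a BO function = CORE part + Faddeev–Popov TAIL part, and the tail fibre transfer is super-polynomially small at slice points
# (lane A of S-BASE, crux `TwistedTraceScaling` stmt-QuantumFields-20203, C4-CORE, the (OD) pen; `pub/ym-fleet/ym-luscher-20007-p1/COARSE-DESIGN.md` §30.3/§30.5)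

§1.  The FP identity behind `…BODefectCoreData.transferApply_boFun_eq_fp` needs a weight with CONSTANT colour mass, which the full weight `fpWeight ε` has (`fpWeight_orbit`,
mass `fpZ ε`) but the core weight `coreWeight ε R₁ = 𝟙_{coreSet}·fpWeight` has not.  With `fpWeight = coreWeight + tailWeight` and linearity in the weight:
* `fpFibreTransfer_add_weight`;  ★★ `transferApply_boFun_eq_core_add_tail` — for every `U`,
  `K̃(φ⊗Ω)(U) = Z⁻¹∫_u φ(u)(∫_c fpFibreTransfer β Ω (coreWeight ε R₁) (c⁻¹Uc) u dc)du + Z⁻¹∫_u φ(u)(∫_c fpFibreTransfer β Ω (tailWeight ε R₁) (c⁻¹Uc) u dc)du`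
  — the first summand is the `K_core` of the (C4)-core estimate, the second (`K_tail`) is the (C5) Faddeev–Popov tail.
§2–§3.  THE TAIL AT SLICE POINTS (the (B-OD) twin of the near/far tails of `…BTFixedBeta.fixed_beta_estimate`, one tube point replaced by a general output point):
* `fpFibreTransfer_le_of_kernel_le` — integration of a pointwise kernel bound on `supp Ω × supp W`: `fpFibreTransfer ≤ M·(∫W)·(∫Ω)`;
* ★★ `fpFibreTransfer_tail_le` — output point with `‖q(U'_e) − 1‖ ≤ a`, `‖q(U'_e) − q((oT u v)_e)‖ ≤ b` on `supp Ω`: tail `≤ e^{2β|E|}e^{−β(min (R₁/2 − 2aε − b) (1/(3L) − 4a − b))²}∫Ω`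
  (`…BTTailKernel.kinDefect_ge_off_core`; needs `b ≪ R₁`, i.e. NEAR slow data);
* ★★ `fpFibreTransfer_far_le` — slice output point `oT u' v'`, FAR slow pair (`‖q(u'_k) − q(u_k)‖ ≥ α` for some `k`), ANY pinned weight `0 ≤ W ≤ 1`: `≤ e^{2β|E|}e^{−β m_far}∫Ω`
  (`…BTTailKernel.kinDefect_ge_far`);
* ★★ `fpFibreTransfer_tail_le_near` (`btMnt`), ★★★ `fpFibreTransfer_tail_conj_le` / `colour_fpFibreTransfer_tail_le` — for EVERY colour rotation `c` the pair `(c⁻¹u'c, u)` is near or far, so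
  at every slice point `oT u' v'` (`‖v̂'‖ ≤ R`, slow window `δ`) and every window datum `u`:
  `∫_c fpFibreTransfer β Ω (tailWeight ε R₁) (c⁻¹(oT u' v')c) u dc ≤ e^{2β|E|}(e^{−β·btMnt} + e^{−β·btMfar})∫Ω dπ` — the SAME exponents the (B-T) β-schedule
  (`…BTTauBudget`, `…BTSchedule`) already drives below `κ₂·btC·λ₀(L³β)`.
SCOPE (recorded for the assembly): the core/tail split is meaningful only at (colour conjugates of) slice points `oT u' v'` with `‖v̂'‖ ≲ r_f ≪ R₁`; the fat tube `{χ ≠ 0}` also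
contains gauge copies `(oT u' v')^h` with `h`-jumps up to `43Mβ^{-s} ≫ R₁`, where `K_tail` is NOT small — the `L²(w)` defect must first be reduced to slice points by the gauge
invariance of `K̃(φ⊗Ω)` and the Gaussian gauge factor of `χ` (COARSE-DESIGN §30.5).
HONEST FRAMING: bookkeeping for a stub of a child of the CONDITIONAL route R2b1; (C5), the final `b`, (B-ST), C4-CORE OPEN; not a gap, not Clay.
-/

set_option autoImplicit false

noncomputable section

open MeasureTheory Filter Topology Real
open scoped BigOperators Quaternion
open Literature.MathematicalPhysics.QuantumFieldTheory
open Literature.MathematicalPhysics.QuantumLattice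

namespace Summit.QuantumFields.YangMills.Theorems.FemtoTransferGap.TwoLattice.ConstTube

open Summit.QuantumFields.YangMills.Theorems.FemtoTransferGap
open Summit.QuantumFields.YangMills.Theorems.FemtoTransferGap.TwoLattice
open Summit.QuantumFields.YangMills.Theorems.FemtoTransferGap.TwoLattice.Avg
open Summit.QuantumFields.YangMills.Theorems.FemtoTransferGap.TwoLattice.Stiff (LinkSpace)

variable {L : ℕ} [NeZero L]

/-- **`fpFibreTransfer` is additive in the weight** (bounded measurable `Ω, W₁, W₂`). [folklore] -/
theorem fpFibreTransfer_add_weight (β : ℝ) {Ω : LinkSpace L → ℝ} (hΩ : Measurable Ω) {CΩ : ℝ} (hCΩ : ∀ x, |Ω x| ≤ CΩ)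
    {W₁ W₂ : (Site 3 L → SU2) → ℝ} (hW₁ : Measurable W₁) {C₁ : ℝ} (hC₁ : ∀ g, |W₁ g| ≤ C₁) (hW₂ : Measurable W₂) {C₂ : ℝ} (hC₂ : ∀ g, |W₂ g| ≤ C₂)
    (U : GaugeConfig 3 L SU2) (u : GaugeConfig 3 1 SU2) :
    fpFibreTransfer L β Ω (W₁ + W₂) U u = fpFibreTransfer L β Ω W₁ U u + fpFibreTransfer L β Ω W₂ U u := by
  haveI := isFiniteMeasure_orthoTransverse L
  obtain ⟨B₁, hB₁⟩ := abs_fpFibreTransfer_integrand_le (L := L) β hCΩ hC₁ U u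
  obtain ⟨B₂, hB₂⟩ := abs_fpFibreTransfer_integrand_le (L := L) β hCΩ hC₂ U u
  have h1 : Integrable (fun p : (Edge 3 L → Fin 3 → ℝ) × (Site 3 L → SU2) => W₁ p.2 * transferKernel su2Rep β U (gaugeTransform p.2 (orthoTube L u p.1)) * Ω (linkEmbed L p.1))
      ((orthoTransverse L).prod (gaugeMeasure L)) := integrable_of_measurable_abs_le _ (measurable_fpFibreTransfer_integrand β hΩ hW₁ U u) hB₁
  have h2 : Integrable (fun p : (Edge 3 L → Fin 3 → ℝ) × (Site 3 L → SU2) => W₂ p.2 * transferKernel su2Rep β U (gaugeTransform p.2 (orthoTube L u p.1)) * Ω (linkEmbed L p.1))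
      ((orthoTransverse L).prod (gaugeMeasure L)) := integrable_of_measurable_abs_le _ (measurable_fpFibreTransfer_integrand β hΩ hW₂ U u) hB₂
  unfold fpFibreTransfer
  rw [← integral_add h1 h2]
  refine integral_congr_ae (ae_of_all _ fun p => ?_)
  simp only [Pi.add_apply]
  ring

/-- ★★ **THE TRANSFER OF A BO FUNCTION = CORE PART + FP-TAIL PART**: for bounded measurable `φ, Ω`, `0 < ε`, any `R₁`, every `U`,
`∫_V K̃(U,V)·boFun φ Ω(V) dV = Z⁻¹∫_u φ(u)(∫_c fpFibreTransfer (coreWeight ε R₁) (c⁻¹Uc) u dc)du + Z⁻¹∫_u φ(u)(∫_c fpFibreTransfer (tailWeight ε R₁) (c⁻¹Uc) u dc)du`, `Z = fpZ ε`.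
[cite: Luscher1983, §3] -/
theorem transferApply_boFun_eq_core_add_tail (β : ℝ) {ε : ℝ} (hε : 0 < ε) (R₁ : ℝ) {φ : GaugeConfig 3 1 SU2 → ℝ} (hφ : Measurable φ) {Cφ : ℝ} (hCφ : ∀ u, |φ u| ≤ Cφ)
    {Ω : LinkSpace L → ℝ} (hΩ : Measurable Ω) {CΩ : ℝ} (hCΩ : ∀ x, |Ω x| ≤ CΩ) (U : GaugeConfig 3 L SU2) :
    ∫ V, avgKernel β U V * boFun L φ Ω V ∂configMeasure SU2 L =
      (fpZ ε)⁻¹ * ∫ u, φ u * (∫ c, fpFibreTransfer L β Ω (coreWeight L ε R₁) (gaugeTransform (fun _ : Site 3 L => c⁻¹) U) u ∂haarProbability SU2) ∂configMeasure SU2 1 +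
      (fpZ ε)⁻¹ * ∫ u, φ u * (∫ c, fpFibreTransfer L β Ω (tailWeight L ε R₁) (gaugeTransform (fun _ : Site 3 L => c⁻¹) U) u ∂haarProbability SU2) ∂configMeasure SU2 1 := by
  haveI : SecondCountableTopology SU2 := secondCountableTopology_su2
  -- the full FP weight has constant colour mass `fpZ ε`
  rw [transferApply_boFun_eq_fp β hφ hCφ hΩ hCΩ (measurable_fpWeight L ε) (abs_fpWeight_le L ε) (fpWeight_orbit L ε) (fpZ_pos hε) U, ← mul_add]
  congr 1
  -- integrability in `c` of the two parts, and in `u` of their colour averages against `φ`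
  obtain ⟨Bc, hBc⟩ := abs_fpFibreTransfer_le' (L := L) β hCΩ (abs_coreWeight_le ε R₁)
  obtain ⟨Bt, hBt⟩ := abs_fpFibreTransfer_le' (L := L) β hCΩ (abs_tailWeight_le ε R₁)
  obtain ⟨Dc, hDc⟩ := abs_colour_fpFibreTransfer_le (L := L) β hCΩ (abs_coreWeight_le ε R₁) U
  obtain ⟨Dt, hDt⟩ := abs_colour_fpFibreTransfer_le (L := L) β hCΩ (abs_tailWeight_le ε R₁) U
  have hIc : ∀ u : GaugeConfig 3 1 SU2, Integrable (fun c : SU2 => fpFibreTransfer L β Ω (coreWeight L ε R₁) (gaugeTransform (fun _ : Site 3 L => c⁻¹) U) u) (haarProbability SU2) :=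
    fun u => integrable_of_measurable_abs_le _ (measurable_fpFibreTransfer_conj β hΩ (measurable_coreWeight ε R₁) U u) fun c => hBc _ u
  have hIt : ∀ u : GaugeConfig 3 1 SU2, Integrable (fun c : SU2 => fpFibreTransfer L β Ω (tailWeight L ε R₁) (gaugeTransform (fun _ : Site 3 L => c⁻¹) U) u) (haarProbability SU2) :=
    fun u => integrable_of_measurable_abs_le _ (measurable_fpFibreTransfer_conj β hΩ (measurable_tailWeight ε R₁) U u) fun c => hBt _ u
  have hJc : Integrable (fun u : GaugeConfig 3 1 SU2 => φ u * ∫ c, fpFibreTransfer L β Ω (coreWeight L ε R₁) (gaugeTransform (fun _ : Site 3 L => c⁻¹) U) u ∂haarProbability SU2)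
      (configMeasure SU2 1) :=
    integrable_of_measurable_abs_le _ (hφ.mul (measurable_colour_fpFibreTransfer β hΩ (measurable_coreWeight ε R₁) U)) fun u => by
      rw [abs_mul]; exact mul_le_mul (hCφ u) (hDc u) (abs_nonneg _) ((abs_nonneg _).trans (hCφ 1))
  have hJt : Integrable (fun u : GaugeConfig 3 1 SU2 => φ u * ∫ c, fpFibreTransfer L β Ω (tailWeight L ε R₁) (gaugeTransform (fun _ : Site 3 L => c⁻¹) U) u ∂haarProbability SU2)
      (configMeasure SU2 1) :=
    integrable_of_measurable_abs_le _ (hφ.mul (measurable_colour_fpFibreTransfer β hΩ (measurable_tailWeight ε R₁) U)) fun u => by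
      rw [abs_mul]; exact mul_le_mul (hCφ u) (hDt u) (abs_nonneg _) ((abs_nonneg _).trans (hCφ 1))
  rw [← integral_add hJc hJt]
  refine integral_congr_ae (ae_of_all _ fun u => ?_)
  dsimp only
  rw [← mul_add, ← integral_add (hIc u) (hIt u)]
  congr 1
  refine integral_congr_ae (ae_of_all _ fun c => ?_)
  dsimp only
  rw [← fpFibreTransfer_add_weight β hΩ hCΩ (measurable_coreWeight ε R₁) (abs_coreWeight_le ε R₁) (measurable_tailWeight ε R₁) (abs_tailWeight_le ε R₁),
    ← fpWeight_eq_core_add_tail (L := L) ε R₁]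

/-! ## §2 The FP-tail fibre transfer is super-polynomially small near the vacuum -/

/-- **Integration of a pointwise kernel bound**: `K(U', (oT u v)^g) ≤ M` on `supp Ω × supp W` (balanced capped fibres), `Ω, W ≥ 0` ⇒
`fpFibreTransfer β Ω W U' u ≤ M·(∫W dg)·(∫Ω dπ)`. [folklore] -/
theorem fpFibreTransfer_le_of_kernel_le (β : ℝ) {Ω : LinkSpace L → ℝ} (hΩm : Measurable Ω) {CΩ : ℝ} (hCΩ : ∀ x, |Ω x| ≤ CΩ) (hΩ0 : ∀ x, 0 ≤ Ω x)
    {W : (Site 3 L → SU2) → ℝ} (hW : Measurable W) {CW : ℝ} (hCW : ∀ g, |W g| ≤ CW) (hW0 : ∀ g, 0 ≤ W g) (U' : GaugeConfig 3 L SU2) (u : GaugeConfig 3 1 SU2)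
    {M : ℝ} (hM0 : 0 ≤ M)
    (hK : ∀ (v : Edge 3 L → Fin 3 → ℝ) (g : Site 3 L → SU2), v ∈ capBalancedSet L → Ω (linkEmbed L v) ≠ 0 → W g ≠ 0 →
      transferKernel su2Rep β U' (gaugeTransform g (orthoTube L u v)) ≤ M) :
    fpFibreTransfer L β Ω W U' u ≤ M * (∫ g, W g ∂gaugeMeasure L) * ∫ v, Ω (linkEmbed L v) ∂orthoTransverse L := by
  haveI := isFiniteMeasure_orthoTransverse L
  have hCΩ0 : 0 ≤ CΩ := (abs_nonneg _).trans (hCΩ 0)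
  have hCW0 : 0 ≤ CW := (abs_nonneg _).trans (hCW 1)
  obtain ⟨B, hB⟩ := abs_fpFibreTransfer_integrand_le (L := L) β hCΩ hCW U' u
  have hint1 : Integrable (fun p : (Edge 3 L → Fin 3 → ℝ) × (Site 3 L → SU2) => W p.2 * transferKernel su2Rep β U' (gaugeTransform p.2 (orthoTube L u p.1)) * Ω (linkEmbed L p.1))
      ((orthoTransverse L).prod (gaugeMeasure L)) := integrable_of_measurable_abs_le _ (measurable_fpFibreTransfer_integrand β hΩm hW U' u) hB
  have hmeas2 : Measurable fun p : (Edge 3 L → Fin 3 → ℝ) × (Site 3 L → SU2) => M * (Ω (linkEmbed L p.1) * W p.2) :=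
    measurable_const.mul ((hΩm.comp ((measurable_linkEmbed L).comp measurable_fst)).mul (hW.comp measurable_snd))
  have hint2 : Integrable (fun p : (Edge 3 L → Fin 3 → ℝ) × (Site 3 L → SU2) => M * (Ω (linkEmbed L p.1) * W p.2)) ((orthoTransverse L).prod (gaugeMeasure L)) := by
    refine integrable_of_measurable_abs_le _ hmeas2 (C := M * (CΩ * CW)) fun p => ?_
    rw [abs_mul, abs_of_nonneg hM0, abs_mul]
    exact mul_le_mul_of_nonneg_left (mul_le_mul (hCΩ _) (hCW _) (abs_nonneg _) hCΩ0) hM0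
  have hcapπ : ∀ᵐ v ∂orthoTransverse L, v ∈ capBalancedSet L := by
    rw [ae_iff]; have h0 := orthoTransverse_compl_capBalancedSet L; simpa only [Set.compl_def] using h0
  have hcap : ∀ᵐ p ∂((orthoTransverse L).prod (gaugeMeasure L)), (p : (Edge 3 L → Fin 3 → ℝ) × (Site 3 L → SU2)).1 ∈ capBalancedSet L :=
    (Measure.quasiMeasurePreserving_fst (μ := orthoTransverse L) (ν := gaugeMeasure L)).ae hcapπ
  have hprod : ∫ p : (Edge 3 L → Fin 3 → ℝ) × (Site 3 L → SU2), M * (Ω (linkEmbed L p.1) * W p.2) ∂((orthoTransverse L).prod (gaugeMeasure L)) =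
      M * (∫ g, W g ∂gaugeMeasure L) * ∫ v, Ω (linkEmbed L v) ∂orthoTransverse L := by
    rw [integral_const_mul, integral_prod_mul (μ := orthoTransverse L) (ν := gaugeMeasure L) (fun v => Ω (linkEmbed L v)) (fun g => W g)]; ring
  unfold fpFibreTransfer
  rw [← hprod]
  refine integral_mono_ae hint1 hint2 ?_
  filter_upwards [hcap] with p hp
  by_cases hΩv : Ω (linkEmbed L p.1) = 0
  · rw [hΩv]; simp
  by_cases hWg : W p.2 = 0
  · rw [hWg]; simp
  have hKle := hK p.1 p.2 hp hΩv hWg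
  have h1 := mul_le_mul_of_nonneg_left hKle (mul_nonneg (hW0 p.2) (hΩ0 (linkEmbed L p.1)))
  nlinarith [h1]

/-- ★★ **OFF-CORE TAIL, abstract form**: if every link of `U'` has `‖q(U'_e) − 1‖ ≤ a` and `‖q(U'_e) − q((oT u v)_e)‖ ≤ b` on `supp Ω` (balanced capped fibres),
`18La ≤ 1/2` and the two floors are `≥ 0`, then `fpFibreTransfer β Ω (tailWeight ε R₁) U' u ≤ e^{2β|E|}·e^{−β·(min (R₁/2 − 2aε − b) (1/(3L) − 4a − b))²}·∫Ω dπ`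
(off the core some gauge jump is `≥ R₁`: `…BTTailKernel.kinDefect_ge_off_core`).  USE: `b ≪ R₁` is essential — the lemma is for output points `U'` on (colour conjugates of)
the slice paired with NEAR slow data (`fpFibreTransfer_tail_le_near`); far slow pairs are `fpFibreTransfer_far_le`. [cite: Luscher1983, §3] -/
theorem fpFibreTransfer_tail_le {β : ℝ} (hβ : 0 ≤ β) {Ω : LinkSpace L → ℝ} (hΩm : Measurable Ω) {CΩ : ℝ} (hCΩ : ∀ x, |Ω x| ≤ CΩ) (hΩ0 : ∀ x, 0 ≤ Ω x)
    {ε R₁ a b : ℝ} (U' : GaugeConfig 3 L SU2) (ha : ∀ e : Edge 3 L, ‖su2Quat (U' e) - 1‖ ≤ a) (u : GaugeConfig 3 1 SU2)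
    (hb : ∀ v : Edge 3 L → Fin 3 → ℝ, v ∈ capBalancedSet L → Ω (linkEmbed L v) ≠ 0 → ∀ e : Edge 3 L, ‖su2Quat (U' e) - su2Quat (orthoTube L u v e)‖ ≤ b)
    (hLa : 18 * L * a ≤ 1 / 2) (hm₁ : 0 ≤ R₁ / 2 - 2 * a * ε - b) (hm₂ : 0 ≤ 1 / (3 * L) - 4 * a - b) :
    fpFibreTransfer L β Ω (tailWeight L ε R₁) U' u ≤
      Real.exp (β * (2 * (Fintype.card (Edge 3 L) : ℝ))) * Real.exp (-(β * (min (R₁ / 2 - 2 * a * ε - b) (1 / (3 * L) - 4 * a - b)) ^ 2)) *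
        ∫ v, Ω (linkEmbed L v) ∂orthoTransverse L := by
  have hWt := measurable_tailWeight (L := L) ε R₁
  have hk : ∀ (v : Edge 3 L → Fin 3 → ℝ) (g : Site 3 L → SU2), v ∈ capBalancedSet L → Ω (linkEmbed L v) ≠ 0 → tailWeight L ε R₁ g ≠ 0 →
      transferKernel su2Rep β U' (gaugeTransform g (orthoTube L u v)) ≤
        Real.exp (β * (2 * (Fintype.card (Edge 3 L) : ℝ))) * Real.exp (-(β * (min (R₁ / 2 - 2 * a * ε - b) (1 / (3 * L) - 4 * a - b)) ^ 2)) := by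
    intro v g hv hΩv hg
    obtain ⟨hoff, hpin⟩ := mem_of_tailWeight_ne_zero hg
    have hdef := kinDefect_ge_off_core U' (orthoTube L u v) g ha (hb v hv hΩv) hpin hLa (exists_jump_ge_of_not_mem_coreSet hoff) hm₁ hm₂
    refine (transferKernel_gaugeTransform_le hβ _ _ g).trans ?_
    rw [← Real.exp_add]
    refine Real.exp_le_exp.mpr ?_
    linarith [mul_le_mul_of_nonneg_left hdef hβ]
  have h := fpFibreTransfer_le_of_kernel_le β hΩm hCΩ hΩ0 hWt (abs_tailWeight_le ε R₁) (fun g => (tailWeight_mem_Icc ε R₁ g).1) U' u (by positivity) hk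
  have hW1 := integral_weight_le_one hWt (tailWeight_mem_Icc (L := L) ε R₁)
  have hI0 : 0 ≤ ∫ v, Ω (linkEmbed L v) ∂orthoTransverse L := integral_nonneg fun v => hΩ0 _
  refine h.trans ?_
  have := mul_le_mul_of_nonneg_left (mul_le_mul_of_nonneg_right hW1 hI0) (by positivity :
    (0 : ℝ) ≤ Real.exp (β * (2 * (Fintype.card (Edge 3 L) : ℝ))) * Real.exp (-(β * (min (R₁ / 2 - 2 * a * ε - b) (1 / (3 * L) - 4 * a - b)) ^ 2)))
  nlinarith [this]

/-- ★★ **FAR SLOW PAIRS, any pinned weight**: for a slice output point `U' = oT u' v'` (`v'` balanced capped, `‖v̂'‖ ≤ R`, `‖q(u'_k) − 1‖ ≤ δ`) and a slow datum `u` with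
`‖q(u'_k) − q(u_k)‖ ≥ α` for some `k`, any measurable weight `0 ≤ W ≤ 1` pinned in the slab (`W g ≠ 0 → colourMean g ∈ fpBall ε`), `Ω ≥ 0` supported in `‖v̂‖ ≤ R`, and
the tube-link bounds `a, b` with the far-pair side conditions of `…BTTailKernel.kinDefect_ge_far`:
`fpFibreTransfer β Ω W U' u ≤ e^{2β|E|}·e^{−β·m_far}·∫Ω dπ`, `m_far = min ((P₀ − 4a − b)²) ((N(1 − 3LP₀)α − J)²/|E|)` (`= btMfar L δ α R ε P₀` at `a = √2R + δ`, `b = 2√2R + 2δ`).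
[cite: Luscher1983, §3] -/
theorem fpFibreTransfer_far_le {β : ℝ} (hβ : 0 ≤ β) {Ω : LinkSpace L → ℝ} (hΩm : Measurable Ω) {CΩ : ℝ} (hCΩ : ∀ x, |Ω x| ≤ CΩ) (hΩ0 : ∀ x, 0 ≤ Ω x) {R : ℝ}
    (hΩt : ∀ v : Edge 3 L → Fin 3 → ℝ, Ω (linkEmbed L v) ≠ 0 → ‖linkEmbed L v‖ ≤ R)
    {W : (Site 3 L → SU2) → ℝ} (hW : Measurable W) (hW1 : ∀ g, 0 ≤ W g ∧ W g ≤ 1) {ε : ℝ} (hε : 0 ≤ ε) (hWpin : ∀ g, W g ≠ 0 → colourMean L g ∈ fpBall ε)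
    {δ α a b P₀ : ℝ} (u' u : GaugeConfig 3 1 SU2) {v' : Edge 3 L → Fin 3 → ℝ} (hv' : v' ∈ capBalancedSet L) (hv'R : ‖linkEmbed L v'‖ ≤ R)
    (ha : ∀ e : Edge 3 L, ‖su2Quat (orthoTube L u' v' e) - 1‖ ≤ a)
    (hb : ∀ v : Edge 3 L → Fin 3 → ℝ, v ∈ capBalancedSet L → Ω (linkEmbed L v) ≠ 0 → ∀ e : Edge 3 L, ‖su2Quat (orthoTube L u' v' e) - su2Quat (orthoTube L u v e)‖ ≤ b)
    (hδ : ∀ k : Fin 3, ‖su2Quat (u' (0, k)) - 1‖ ≤ δ) (hfar : ∃ k : Fin 3, α ≤ ‖su2Quat (u' (0, k)) - su2Quat (u (0, k))‖)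
    (hP : 3 * L * P₀ < 1) (hP0 : 0 ≤ P₀ - 4 * a - b)
    (hJ : 2 * ε * Fintype.card (Site 3 L) * δ + 2 * R ^ 2 + 2 * Real.sqrt 2 * Fintype.card (Site 3 L) * (9 * L * P₀ + ε) * R ≤ Fintype.card (Site 3 L) * (1 - 3 * L * P₀) * α) :
    fpFibreTransfer L β Ω W (orthoTube L u' v') u ≤
      Real.exp (β * (2 * (Fintype.card (Edge 3 L) : ℝ))) * Real.exp (-(β * (min ((P₀ - 4 * a - b) ^ 2) ((Fintype.card (Site 3 L) * (1 - 3 * L * P₀) * α - (2 * ε * Fintype.card (Site 3 L) * δ + 2 * R ^ 2 + 2 * Real.sqrt 2 * Fintype.card (Site 3 L) * (9 * L * P₀ + ε) * R)) ^ 2 / Fintype.card (Edge 3 L))))) * ∫ v, Ω (linkEmbed L v) ∂orthoTransverse L := by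
  have hW0 : ∀ g, 0 ≤ W g := fun g => (hW1 g).1
  have hWabs : ∀ g, |W g| ≤ 1 := fun g => by rw [abs_of_nonneg (hW1 g).1]; exact (hW1 g).2
  have hk : ∀ (v : Edge 3 L → Fin 3 → ℝ) (g : Site 3 L → SU2), v ∈ capBalancedSet L → Ω (linkEmbed L v) ≠ 0 → W g ≠ 0 →
      transferKernel su2Rep β (orthoTube L u' v') (gaugeTransform g (orthoTube L u v)) ≤
        Real.exp (β * (2 * (Fintype.card (Edge 3 L) : ℝ))) * Real.exp (-(β * (min ((P₀ - 4 * a - b) ^ 2) ((Fintype.card (Site 3 L) * (1 - 3 * L * P₀) * α - (2 * ε * Fintype.card (Site 3 L) * δ + 2 * R ^ 2 + 2 * Real.sqrt 2 * Fintype.card (Site 3 L) * (9 * L * P₀ + ε) * R)) ^ 2 / Fintype.card (Edge 3 L))))) := by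
    intro v g hv hΩv hg
    have hdef := kinDefect_ge_far u' u hv' hv g ha (hb v hv hΩv) hε (hWpin g hg) hδ hfar hv'R (hΩt v hΩv) hP hP0 hJ
    refine (transferKernel_gaugeTransform_le hβ _ _ g).trans ?_
    rw [← Real.exp_add]
    refine Real.exp_le_exp.mpr ?_
    linarith [mul_le_mul_of_nonneg_left hdef hβ]
  have h := fpFibreTransfer_le_of_kernel_le β hΩm hCΩ hΩ0 hW hWabs hW0 (orthoTube L u' v') u (by positivity) hk
  have hI1 := integral_weight_le_one hW hW1
  have hI0 : 0 ≤ ∫ v, Ω (linkEmbed L v) ∂orthoTransverse L := integral_nonneg fun v => hΩ0 _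
  refine h.trans ?_
  have := mul_le_mul_of_nonneg_left (mul_le_mul_of_nonneg_right hI1 hI0) (by positivity :
    (0 : ℝ) ≤ Real.exp (β * (2 * (Fintype.card (Edge 3 L) : ℝ))) * Real.exp (-(β * (min ((P₀ - 4 * a - b) ^ 2) ((Fintype.card (Site 3 L) * (1 - 3 * L * P₀) * α - (2 * ε * Fintype.card (Site 3 L) * δ + 2 * R ^ 2 + 2 * Real.sqrt 2 * Fintype.card (Site 3 L) * (9 * L * P₀ + ε) * R)) ^ 2 / Fintype.card (Edge 3 L))))))
  nlinarith [this]

/-! ## §3 Slice forms in the (B-T) currency: near pairs `btMnt`, far pairs `btMfar`, and the colour-uniform bound -/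

/-- ★★ **NEAR SLOW PAIRS on the slice**: `U' = oT u' v'` (`v'` balanced capped, `‖v̂'‖ ≤ R`), `‖q(u'_k) − 1‖ ≤ δ`, `‖q(u'_k) − q(u_k)‖ ≤ α` for all `k`, `Ω ≥ 0` supported in
`‖v̂‖ ≤ R`: `fpFibreTransfer β Ω (tailWeight ε R₁) U' u ≤ e^{2β|E|}·e^{−β·btMnt L δ α R R₁ ε}·∫Ω dπ` (tube-link bounds `a = √2R + δ`, `b = 2√2R + α`, exactly as in
`…BTFixedBeta.fixed_beta_estimate`). [cite: Luscher1983, §3] -/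
theorem fpFibreTransfer_tail_le_near {β : ℝ} (hβ : 0 ≤ β) {Ω : LinkSpace L → ℝ} (hΩm : Measurable Ω) {CΩ : ℝ} (hCΩ : ∀ x, |Ω x| ≤ CΩ) (hΩ0 : ∀ x, 0 ≤ Ω x) {R : ℝ}
    (hΩt : ∀ v : Edge 3 L → Fin 3 → ℝ, Ω (linkEmbed L v) ≠ 0 → ‖linkEmbed L v‖ ≤ R) {ε R₁ δ α : ℝ}
    (u' u : GaugeConfig 3 1 SU2) {v' : Edge 3 L → Fin 3 → ℝ} (hv' : v' ∈ capBalancedSet L) (hv'R : ‖linkEmbed L v'‖ ≤ R)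
    (hδ : ∀ k : Fin 3, ‖su2Quat (u' (0, k)) - 1‖ ≤ δ) (hnear : ∀ k : Fin 3, ‖su2Quat (u' (0, k)) - su2Quat (u (0, k))‖ ≤ α)
    (hLa : 18 * L * (Real.sqrt 2 * R + δ) ≤ 1 / 2)
    (hm₁ : 0 ≤ R₁ / 2 - 2 * (Real.sqrt 2 * R + δ) * ε - (2 * Real.sqrt 2 * R + α)) (hm₂ : 0 ≤ 1 / (3 * L) - 4 * (Real.sqrt 2 * R + δ) - (2 * Real.sqrt 2 * R + α)) :
    fpFibreTransfer L β Ω (tailWeight L ε R₁) (orthoTube L u' v') u ≤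
      Real.exp (β * (2 * (Fintype.card (Edge 3 L) : ℝ))) * Real.exp (-(β * btMnt L δ α R R₁ ε)) * ∫ v, Ω (linkEmbed L v) ∂orthoTransverse L := by
  have hv'1 : ∀ e, ∑ c, v' e c ^ 2 ≤ 1 := sum_sq_le_one_of_cap L hv'.2
  have ha : ∀ e : Edge 3 L, ‖su2Quat (orthoTube L u' v' e) - 1‖ ≤ Real.sqrt 2 * R + δ := fun e =>
    (norm_su2Quat_orthoTube_sub_one_le u' hv'1 e).trans (add_le_add (mul_le_mul_of_nonneg_left hv'R (Real.sqrt_nonneg _)) (hδ e.2))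
  have hb : ∀ v : Edge 3 L → Fin 3 → ℝ, v ∈ capBalancedSet L → Ω (linkEmbed L v) ≠ 0 → ∀ e : Edge 3 L,
      ‖su2Quat (orthoTube L u' v' e) - su2Quat (orthoTube L u v e)‖ ≤ 2 * Real.sqrt 2 * R + α := fun v hv hΩv e =>
    (norm_su2Quat_orthoTube_sub_orthoTube_le u' u hv'1 (sum_sq_le_one_of_cap L hv.2) e).trans (by
      have h1 := mul_le_mul_of_nonneg_left hv'R (Real.sqrt_nonneg 2)
      have h2 := mul_le_mul_of_nonneg_left (hΩt v hΩv) (Real.sqrt_nonneg 2)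
      linarith [hnear e.2])
  have h := fpFibreTransfer_tail_le hβ hΩm hCΩ hΩ0 (ε := ε) (R₁ := R₁) (orthoTube L u' v') ha u hb hLa hm₁ hm₂
  unfold btMnt
  exact h

/-- ★★★ **THE COLOUR-UNIFORM TAIL BOUND on the slice**: for EVERY colour rotation `c`, the pair `(c⁻¹u'c, u)` is near or far, so
`fpFibreTransfer β Ω (tailWeight ε R₁) (c⁻¹(oT u' v')c) u ≤ e^{2β|E|}·(e^{−β·btMnt} + e^{−β·btMfar})·∫Ω dπ` and hence the same bound for the colour average
`∫_c … dc` (probability Haar); `Ω` is assumed colour-invariant-supported only through `‖v̂‖ ≤ R` (rotation preserves the norm and the balanced cap). [cite: Luscher1983, §3] -/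
theorem fpFibreTransfer_tail_conj_le {β : ℝ} (hβ : 0 ≤ β) {Ω : LinkSpace L → ℝ} (hΩm : Measurable Ω) {CΩ : ℝ} (hCΩ : ∀ x, |Ω x| ≤ CΩ) (hΩ0 : ∀ x, 0 ≤ Ω x) {R : ℝ}
    (hΩt : ∀ v : Edge 3 L → Fin 3 → ℝ, Ω (linkEmbed L v) ≠ 0 → ‖linkEmbed L v‖ ≤ R) {ε R₁ δ α P₀ : ℝ} (hε : 0 ≤ ε)
    (u' u : GaugeConfig 3 1 SU2) {v' : Edge 3 L → Fin 3 → ℝ} (hv' : v' ∈ capBalancedSet L) (hv'R : ‖linkEmbed L v'‖ ≤ R)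
    (hδ' : ∀ k : Fin 3, ‖su2Quat (u' (0, k)) - 1‖ ≤ δ) (hδ : ∀ k : Fin 3, ‖su2Quat (u (0, k)) - 1‖ ≤ δ)
    (hLa : 18 * L * (Real.sqrt 2 * R + δ) ≤ 1 / 2)
    (hm₁ : 0 ≤ R₁ / 2 - 2 * (Real.sqrt 2 * R + δ) * ε - (2 * Real.sqrt 2 * R + α)) (hm₂ : 0 ≤ 1 / (3 * L) - 4 * (Real.sqrt 2 * R + δ) - (2 * Real.sqrt 2 * R + α))
    (hP : 3 * L * P₀ < 1) (hP0 : 0 ≤ P₀ - 4 * (Real.sqrt 2 * R + δ) - (2 * Real.sqrt 2 * R + 2 * δ))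
    (hJ : 2 * ε * Fintype.card (Site 3 L) * δ + 2 * R ^ 2 + 2 * Real.sqrt 2 * Fintype.card (Site 3 L) * (9 * L * P₀ + ε) * R ≤ Fintype.card (Site 3 L) * (1 - 3 * L * P₀) * α)
    (c : SU2) :
    fpFibreTransfer L β Ω (tailWeight L ε R₁) (gaugeTransform (fun _ : Site 3 L => c⁻¹) (orthoTube L u' v')) u ≤
      Real.exp (β * (2 * (Fintype.card (Edge 3 L) : ℝ))) * (Real.exp (-(β * btMnt L δ α R R₁ ε)) + Real.exp (-(β * btMfar L δ α R ε P₀))) *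
        ∫ v, Ω (linkEmbed L v) ∂orthoTransverse L := by
  rw [fpFibreTransfer_conj_orthoTube β Ω _ c u' u hv']
  set u'' : GaugeConfig 3 1 SU2 := gaugeTransform (fun _ : Site 3 1 => c⁻¹) u' with hu''
  set v'' : Edge 3 L → Fin 3 → ℝ := colourRotate L (fun _ => c⁻¹) v' with hv''
  have hv''c : v'' ∈ capBalancedSet L := colourRotate_mem_capBalancedSet L hv'
  have hv''R : ‖linkEmbed L v''‖ ≤ R := by rw [hv'', linkEmbed_colourRotate_const, LinearIsometryEquiv.norm_map]; exact hv'R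
  have hδ'' : ∀ k : Fin 3, ‖su2Quat (u'' (0, k)) - 1‖ ≤ δ := fun k => by
    rw [hu'', show gaugeTransform (fun _ : Site 3 1 => c⁻¹) u' (0, k) = c⁻¹ * u' (0, k) * (c⁻¹)⁻¹ from rfl, norm_su2Quat_conj_sub_one]; exact hδ' k
  have hI0 : 0 ≤ ∫ v, Ω (linkEmbed L v) ∂orthoTransverse L := integral_nonneg fun v => hΩ0 _
  have hE0 : 0 ≤ Real.exp (β * (2 * (Fintype.card (Edge 3 L) : ℝ))) := (Real.exp_pos _).le
  by_cases hnear : ∀ k : Fin 3, ‖su2Quat (u'' (0, k)) - su2Quat (u (0, k))‖ ≤ α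
  · have h := fpFibreTransfer_tail_le_near hβ hΩm hCΩ hΩ0 hΩt (ε := ε) (R₁ := R₁) u'' u hv''c hv''R hδ'' hnear hLa hm₁ hm₂
    refine h.trans ?_
    have hx : 0 ≤ Real.exp (β * (2 * (Fintype.card (Edge 3 L) : ℝ))) * Real.exp (-(β * btMfar L δ α R ε P₀)) * ∫ v, Ω (linkEmbed L v) ∂orthoTransverse L := by positivity
    nlinarith [hx]
  · push Not at hnear
    obtain ⟨k, hk⟩ := hnear
    have hv''1 : ∀ e, ∑ a, v'' e a ^ 2 ≤ 1 := sum_sq_le_one_of_cap L hv''c.2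
    have ha : ∀ e : Edge 3 L, ‖su2Quat (orthoTube L u'' v'' e) - 1‖ ≤ Real.sqrt 2 * R + δ := fun e =>
      (norm_su2Quat_orthoTube_sub_one_le u'' hv''1 e).trans (add_le_add (mul_le_mul_of_nonneg_left hv''R (Real.sqrt_nonneg _)) (hδ'' e.2))
    have hduu : ∀ k : Fin 3, ‖su2Quat (u'' (0, k)) - su2Quat (u (0, k))‖ ≤ 2 * δ := fun k => by
      have := norm_sub_le_norm_sub_add_norm_sub (su2Quat (u'' (0, k))) 1 (su2Quat (u (0, k)))
      rw [norm_sub_rev (1 : ℍ)] at this; linarith [hδ'' k, hδ k]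
    have hb : ∀ v : Edge 3 L → Fin 3 → ℝ, v ∈ capBalancedSet L → Ω (linkEmbed L v) ≠ 0 → ∀ e : Edge 3 L,
        ‖su2Quat (orthoTube L u'' v'' e) - su2Quat (orthoTube L u v e)‖ ≤ 2 * Real.sqrt 2 * R + 2 * δ := fun v hv hΩv e =>
      (norm_su2Quat_orthoTube_sub_orthoTube_le u'' u hv''1 (sum_sq_le_one_of_cap L hv.2) e).trans (by
        have h1 := mul_le_mul_of_nonneg_left hv''R (Real.sqrt_nonneg 2)
        have h2 := mul_le_mul_of_nonneg_left (hΩt v hΩv) (Real.sqrt_nonneg 2)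
        linarith [hduu e.2])
    have h := fpFibreTransfer_far_le hβ hΩm hCΩ hΩ0 hΩt (measurable_tailWeight ε R₁) (tailWeight_mem_Icc ε R₁) hε
      (fun g hg => (mem_of_tailWeight_ne_zero hg).2) u'' u hv''c hv''R ha hb hδ'' ⟨k, hk.le⟩ hP hP0 hJ
    unfold btMfar
    refine h.trans ?_
    have hx : 0 ≤ Real.exp (β * (2 * (Fintype.card (Edge 3 L) : ℝ))) * Real.exp (-(β * btMnt L δ α R R₁ ε)) * ∫ v, Ω (linkEmbed L v) ∂orthoTransverse L := by positivity
    nlinarith [hx]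

/-- ★★ The colour AVERAGE of the tail fibre transfer at a slice point obeys the same bound (probability Haar). [cite: Luscher1983, §3] -/
theorem colour_fpFibreTransfer_tail_le {β : ℝ} (hβ : 0 ≤ β) {Ω : LinkSpace L → ℝ} (hΩm : Measurable Ω) {CΩ : ℝ} (hCΩ : ∀ x, |Ω x| ≤ CΩ) (hΩ0 : ∀ x, 0 ≤ Ω x) {R : ℝ}
    (hΩt : ∀ v : Edge 3 L → Fin 3 → ℝ, Ω (linkEmbed L v) ≠ 0 → ‖linkEmbed L v‖ ≤ R) {ε R₁ δ α P₀ : ℝ} (hε : 0 ≤ ε)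
    (u' u : GaugeConfig 3 1 SU2) {v' : Edge 3 L → Fin 3 → ℝ} (hv' : v' ∈ capBalancedSet L) (hv'R : ‖linkEmbed L v'‖ ≤ R)
    (hδ' : ∀ k : Fin 3, ‖su2Quat (u' (0, k)) - 1‖ ≤ δ) (hδ : ∀ k : Fin 3, ‖su2Quat (u (0, k)) - 1‖ ≤ δ)
    (hLa : 18 * L * (Real.sqrt 2 * R + δ) ≤ 1 / 2)
    (hm₁ : 0 ≤ R₁ / 2 - 2 * (Real.sqrt 2 * R + δ) * ε - (2 * Real.sqrt 2 * R + α)) (hm₂ : 0 ≤ 1 / (3 * L) - 4 * (Real.sqrt 2 * R + δ) - (2 * Real.sqrt 2 * R + α))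
    (hP : 3 * L * P₀ < 1) (hP0 : 0 ≤ P₀ - 4 * (Real.sqrt 2 * R + δ) - (2 * Real.sqrt 2 * R + 2 * δ))
    (hJ : 2 * ε * Fintype.card (Site 3 L) * δ + 2 * R ^ 2 + 2 * Real.sqrt 2 * Fintype.card (Site 3 L) * (9 * L * P₀ + ε) * R ≤ Fintype.card (Site 3 L) * (1 - 3 * L * P₀) * α) :
    ∫ c, fpFibreTransfer L β Ω (tailWeight L ε R₁) (gaugeTransform (fun _ : Site 3 L => c⁻¹) (orthoTube L u' v')) u ∂haarProbability SU2 ≤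
      Real.exp (β * (2 * (Fintype.card (Edge 3 L) : ℝ))) * (Real.exp (-(β * btMnt L δ α R R₁ ε)) + Real.exp (-(β * btMfar L δ α R ε P₀))) *
        ∫ v, Ω (linkEmbed L v) ∂orthoTransverse L := by
  have h := integral_mono_of_nonneg (μ := haarProbability SU2)
    (ae_of_all _ fun c => fpFibreTransfer_nonneg β hΩ0 (fun g => (tailWeight_mem_Icc (L := L) ε R₁ g).1) (gaugeTransform (fun _ : Site 3 L => c⁻¹) (orthoTube L u' v')) u)
    (integrable_const _) (ae_of_all _ fun c => fpFibreTransfer_tail_conj_le hβ hΩm hCΩ hΩ0 hΩt hε u' u hv' hv'R hδ' hδ hLa hm₁ hm₂ hP hP0 hJ c)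
  simpa using h

end Summit.QuantumFields.YangMills.Theorems.FemtoTransferGap.TwoLattice.ConstTube

end
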